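import Summits.QuantumFields.BalabanUV.Beta.SymSecondOrderClassBase
import Summits.QuantumFields.BalabanUV.Beta.SymMixedRemainderClass
import Summits.QuantumFields.BalabanUV.Beta.SecondOrderSplitDecay
import Summits.QuantumFields.BalabanUV.Beta.SecondOrderRemainderTables

/-!
# `BalabanUV.Beta.SymSecondOrderDeltaSep` — binder row D1, hR side of the (0.4) ROOT: **THE Δ-HALF OF THE CLASS STEP AND THE CLASS INDUCTION —
# the OWNER's defined split defect `symΔAn1 … j α` is separation-localised from the classes of `X2s j α` and `symR2An1 … j α`; hence, for a
# separation-localised free table `X2s` (in particular at the pin `X2s := 0`), EVERY `symR2An1 … j α` is `LocStencil₂`, EVERY `symΔAn1 … j α` is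
# separation-localised, and ROOT L∕M's binder `hΔL` holds**
# (β sub-cell, D1 formalisation swarm, unit `b2b-balaban-beta-d1-formalise-leaf-03`, gen 17; the row-D1 OWNER an2's GO R-D1-g33-0, journal l.35557,
# target signature `sep_symΔAn1_of_classes` VERBATIM)

NOT IN PRINT; OUR BOOKKEEPING.  HONEST FRAMING (cell contract, verbatim): «discharging `BetaPertH` makes Bałaban's UV stability
UNCONDITIONAL — a real constructive-QFT result; it is NOT the continuum limit and NOT the Clay problem.»  HONEST DEPENDENCY (verbatim):
«continuum YM on T⁴ ⇐ BetaPertH ∧ nine spine estimates (0/9 proved); BetaPertH ⇐ (D1) ∧ (D4) ∧ CAP+tail; G-an2-4 gates asym, D1 and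
NE2/3/4.»  [folklore] exponential-localisation bookkeeping over OUR objects; instantiates NO binder of the β-function wall; no `[cite:]`, no `def`,
no `def … : Prop`; NOT D1, NOT `BetaPertH`, NOT continuum, NOT Clay.

## What

* §1 `sep_conjW_word` (generic): the contact word `(b, c) ↦ conjW 𝕄 (A b) (A c) (D b) (D c) (X₂ b c)` of two vertex families `A`, `D` and a
  separation-localised bond-pair family `X₂`, against a decaying `𝕄`, is separation-localised (unfold `conjW = conjW₁ + conjW₂` into ten products;
  `SecondOrderDefectWordsSep.sep_comp_vertexFamily`, leaf-05's `sep_swap`, `SymSecondOrderClassStep.sep_comp_decays_left ∕ _right`).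
* §2 `sep_diagK_sharpSymbol` (generic): leaf-10's DRESSED SECOND SYMBOL `X₂⋆ b c = (Σ colH_b Σ colH_c h) + Σ colH[K2OfK_c + Ξ_c]_b g` is separation-
  localised through `diagK` (`diagK_dressed₂_eq_vertex2OfK` + `sep_vertex2OfK`; `diagK_dressed_eq_vertexOfK` + `sep_vertexOfK_diag_of_vertexFamily`
  over `vertexFamily_K2OfK_add_Xi`).
* §3 `symΔOfAt_eq_sharp` — THE EXPLICIT FORM OF THE OWNER's SPLIT DEFECT at the (0.4) literal: for any `LocStencil₂` remainder `Rj`,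
  `symΔOfAt … j Rj α μ y ν y′ = conjW 𝕄_j (dM_b) (dM_c) (𝒟_b) (𝒟_c) (diagK X₂⋆_{bc}) − conjW 𝕄_j (dM_b) (dM_c) (𝒟_b) (𝒟_c) (diagK (X2s j α b c)) + dM (Ξ_c) Lc S M b
   + (vertex2OfK G_j Lc (Rj α) b c + (mixOfK G_j Lc (symRMrAn1 … j α) b c + mixOfK G_j Lc (symRMrAn1 … j α) c b))`
  (leaf-10's `SecondOrderSplitDecay.W2OfK_sharp_split_of_decay` at the (0.4) letters after `add_right_comm` in both second-order slots, an2's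
  `SecondOrderRemainderTables.W2OfK_add_slot₂`; the comb twin is leaf-10's `SecondOrderSplitLiteral.W2OfK_sharp_split_literal₂`).
* §4 **`sep_symΔAn1_of_classes (N cΛ γ X2s j α) (hX) (hR2) : ∃ C δ, 0 < δ ∧ ∀ μ y ν y', BiLoc (symΔAn1 Lc N cΛ γ X2s j α μ y ν y') (Lc•y) (Lc•y) (C·e^{−δ·l1 (Lc•y − Lc•y')}) δ`**
  — the OWNER's signature: §3 + §1 ×2 + §2 + leaf-05's `sep_dM_of_vertexFamily ∕ sep_vertex2OfK ∕ sep_mixOfK(_swap)` + `SymMixedRemainderClass.locStencilFM_symRMrAn1`.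
* §5 THE INDUCTION: `classes_symR2An1_symΔAn1 (hX : ∀ j, sep (X2s j α)) : ∀ j, classR2 j α ∧ sepΔ j α` (base `SymSecondOrderClassBase.locStencil₂_symR2An1_zero`,
  step `SymSecondOrderClassStep.locStencil₂_symR2An1_succ` + §4); corollaries `locStencil₂_symR2An1`, `sep_symΔAn1`, the POINTWISE `loc_symΔAn1`
  (ROOT L's `hΔL` under the `X2s` class) and `hΔL_pinned` (ROOT M's `hΔL`, `X2s := 0`, NO hypothesis).
Provenance: β sub-cell, unit `b2b-balaban-beta-d1-formalise-leaf-03` gen 17, 2026-08-21 (v1); no existing file touched.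
-/

noncomputable section

open Finset
open scoped BigOperators
open Literature.MathematicalPhysics.QuantumFieldTheory
open Literature.MathematicalPhysics.QuantumFieldTheory.Balaban1983to89
open Literature.MathematicalPhysics.QuantumFieldTheory.Balaban1983to89.Beta
open B12Sec2to5 (l1 l1_nonneg)
open ExpKernelCalculus (MKer Decays BiLoc VertexFamily comp l1_sub_symm)
open PolarizationSign (reflSign)
open KernelReflection (refK)
open ResolventReflection (bref Φ)
open KernelWard (biLoc_add biLoc_sub)
open AveragingContoursRooted (ctr ctrOff ctrOff_mem_box)
open OneStepResolventKernel (Fib LocStencil biLoc_mono decays_mono)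
open OneStepKernelFamily (colH vertexOfK)
open BalabanStepJetsSucc (wVH)
open BalabanStepW2 (M2Of wV4 wB2 locStencilFM_M2Of)
open BalabanCompositeJets (LocStencil₂)
open SecondOrderResponse (dM K2OfK vertex2OfK mixOfK W2OfK LocStencilFM)
open WilsonVertex2Sym (wsym22)
open Summit.QuantumFields.BalabanUV.Beta.TameKernelCalculus
open Summit.QuantumFields.BalabanUV.Beta.ChartConjugation (conjV conjW conjW₁ conjW₂)
open Summit.QuantumFields.BalabanUV.Beta.AxialDressingRooted (one_le_of_neZero)
open Summit.QuantumFields.BalabanUV.Beta.BorderedHessian (bhK diagK spr_bhK)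
open Summit.QuantumFields.BalabanUV.Beta.SecondOrderSplitDecay (diagK_dressed_eq_vertexOfK W2OfK_sharp_split_of_decay)
open Summit.QuantumFields.BalabanUV.Beta.SecondOrderSplitLoc (diagK_add' diagK_dressed₂_eq_vertex2OfK)
open Summit.QuantumFields.BalabanUV.Beta.SecondOrderRemainderTables (abs_le_of_locStencil₂ abs_le_of_locStencilFM W2OfK_add_slot₂)
open Summit.QuantumFields.BalabanUV.Beta.SecondOrderSeparationCalculus (sep_of_le sep_add sep_neg sep_swap sep_conjV sep_dM_of_vertexFamily
  sep_vertexOfK_diag_of_vertexFamily sep_vertex2OfK sep_mixOfK sep_mixOfK_swap vertexFamily_dressedGen vertexFamily_conjV vertexFamily_Xi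
  vertexFamily_K2OfK_add_Xi)
open Summit.QuantumFields.BalabanUV.Beta.SecondOrderDefectWordsSep (sep_comp_vertexFamily vertexFamily_dM' vertexFamily_comp_decays_right)
open Summit.QuantumFields.BalabanUV.Beta.SymSecondOrderClassStep (sep_comp_decays_left sep_comp_decays_right sep_sub pkg_of_spr locStencil₂_symR2An1_succ)
open Summit.QuantumFields.BalabanUV.Beta.SymSecondOrderClassBase (locStencil₂_T2RecOf_symTablesAn1 locStencil₂_symR2An1_zero)
open Summit.QuantumFields.BalabanUV.Beta.SymMixedRemainderClass (locStencilFM_symRMrAn1)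
open Summit.QuantumFields.BalabanUV.Beta.SymmetrisedStepJets (Gsym decays_Gsym)
open Summit.QuantumFields.BalabanUV.Beta.SpineRooted (M1Of SpureRecOf T2RecOf locStencil_SpureRecOf vertexFamily_M1Of)
open Summit.QuantumFields.BalabanUV.Beta.SymShiftedSpread (bhKStepSh spr_bhKStepSh)
open Summit.QuantumFields.BalabanUV.Beta.RelInvNullShift (spr_add)
open Summit.QuantumFields.BalabanUV.Beta.DshAn1 (Dsh spr_Dsh)
open Summit.QuantumFields.BalabanUV.Beta.E3ContactGenerator (ctGenM)
open Summit.QuantumFields.BalabanUV.Beta.SymAveragingHessianCounts (symVhSAt symHessFFAt symVhSAt_hV_ctr symHessFFAt_hH_ctr)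
open Summit.QuantumFields.BalabanUV.Beta.SymAveragingMixedJetTables (symMixFFAt)
open Summit.QuantumFields.BalabanUV.Beta.SymSecondOrderTablesAn1 (symVh₂SAn1 symMixFFAt_hmix_ctr)
open Summit.QuantumFields.BalabanUV.Beta.SymSecondOrderSplitLoc (locStencil_diagK_mul_ctGenM abs_ctGenM_mul_ctGenM_le locStencil₂_diagK_ctGenM_mul_ctGenM)
open Summit.QuantumFields.BalabanUV.Beta.SymMixedReflectionLetterAn1 (symRMrAn1)
open Summit.QuantumFields.BalabanUV.Beta.SymSecondOrderRemainderAn1 (symΔOfAt symR2An1 symΔAn1)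

namespace Summit.QuantumFields.BalabanUV.Beta.SymSecondOrderDeltaSep

variable {d N : ℕ}

/-! ## §1 The contact word of two vertex families and a separation-localised second table -/

section ConjW

variable {𝕄 : MKer (d + 1) (Fib d)} {A D : Fin (d + 1) → (Fin (d + 1) → ℤ) → MKer (d + 1) (Fib d)}
  {X₂ : Fin (d + 1) → (Fin (d + 1) → ℤ) → Fin (d + 1) → (Fin (d + 1) → ℤ) → MKer (d + 1) (Fib d)}

/-- [folklore] **THE CONTACT WORD IS SEPARATION-LOCALISED**: for a decaying `𝕄`, vertex families `A`, `D` and a separation-localised bond-pair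
family `X₂`, `(μ,y,ν,y′) ↦ conjW 𝕄 (A μ y) (A ν y′) (D μ y) (D ν y′) (X₂ μ y ν y′)` is bi-localised at `(N•y, N•y)` with a constant decaying in
`|N•y − N•y′|₁` (the ten products of `conjW₁ + conjW₂`, each a product of a factor at `y` with a factor at `y′`, or a conjugate of `X₂`). -/
theorem sep_conjW_word (h𝕄 : ∃ δ C : ℝ, 0 < δ ∧ 0 ≤ C ∧ Decays 𝕄 C δ)
    (hA : ∃ CA δA : ℝ, 0 < δA ∧ VertexFamily A N CA δA) (hD : ∃ CD δD : ℝ, 0 < δD ∧ VertexFamily D N CD δD)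
    (hX : ∃ C δ : ℝ, 0 < δ ∧ ∀ μ y ν y', BiLoc (X₂ μ y ν y') ((N : ℤ) • y) ((N : ℤ) • y) (C * Real.exp (-δ * l1 ((N : ℤ) • y - (N : ℤ) • y'))) δ) :
    ∃ C δ : ℝ, 0 < δ ∧ ∀ μ y ν y', BiLoc (conjW 𝕄 (A μ y) (A ν y') (D μ y) (D ν y') (X₂ μ y ν y')) ((N : ℤ) • y) ((N : ℤ) • y)
      (C * Real.exp (-δ * l1 ((N : ℤ) • y - (N : ℤ) • y'))) δ := by
  have e : (fun μ y ν y' => conjW 𝕄 (A μ y) (A ν y') (D μ y) (D ν y') (X₂ μ y ν y')) = fun μ y ν y' =>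
      ((comp (A ν y') (D μ y) - comp (D μ y) (A ν y')) + (comp (A μ y) (D ν y') - comp (D ν y') (A μ y))) +
      ((comp (comp (D μ y) (D ν y')) 𝕄 + comp (comp (D ν y') (D μ y)) 𝕄) - (comp (comp (D μ y) 𝕄) (D ν y') + comp (comp (D ν y') 𝕄) (D μ y)) +
        (comp 𝕄 (X₂ μ y ν y') - comp (X₂ μ y ν y') 𝕄)) := by
    funext μ y ν y'; rfl
  have hAD := sep_comp_vertexFamily hA hD
  have hDA := sep_comp_vertexFamily hD hA
  have hDD := sep_comp_vertexFamily hD hD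
  have hDMD := sep_comp_vertexFamily (vertexFamily_comp_decays_right h𝕄 hD) hD
  have h : ∃ C δ : ℝ, 0 < δ ∧ ∀ μ y ν y', BiLoc ((fun μ y ν y' =>
      ((comp (A ν y') (D μ y) - comp (D μ y) (A ν y')) + (comp (A μ y) (D ν y') - comp (D ν y') (A μ y))) +
      ((comp (comp (D μ y) (D ν y')) 𝕄 + comp (comp (D ν y') (D μ y)) 𝕄) - (comp (comp (D μ y) 𝕄) (D ν y') + comp (comp (D ν y') 𝕄) (D μ y)) +
        (comp 𝕄 (X₂ μ y ν y') - comp (X₂ μ y ν y') 𝕄))) μ y ν y') ((N : ℤ) • y) ((N : ℤ) • y)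
      (C * Real.exp (-δ * l1 ((N : ℤ) • y - (N : ℤ) • y'))) δ :=
    sep_add (sep_add (sep_sub (sep_swap hAD) hDA) (sep_sub hAD (sep_swap hDA)))
      (sep_add (sep_sub (sep_add (sep_comp_decays_right h𝕄 hDD) (sep_comp_decays_right h𝕄 (sep_swap hDD))) (sep_add hDMD (sep_swap hDMD)))
        (sep_sub (sep_comp_decays_left h𝕄 hX) (sep_comp_decays_right h𝕄 hX)))
  obtain ⟨C, δ, hδ, h'⟩ := h
  refine ⟨C, δ, hδ, fun μ y ν y' => ?_⟩
  rw [show conjW 𝕄 (A μ y) (A ν y') (D μ y) (D ν y') (X₂ μ y ν y') =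
      (fun μ y ν y' => conjW 𝕄 (A μ y) (A ν y') (D μ y) (D ν y') (X₂ μ y ν y')) μ y ν y' from rfl, e]
  exact h' μ y ν y'

end ConjW

/-! ## §2 The dressed (sharp) second symbol is separation-localised -/

section Sharp

variable {K 𝕄 : MKer (d + 1) (Fib d)}

/-- [folklore] **leaf-10's DRESSED SECOND SYMBOL IS SEPARATION-LOCALISED**: decaying `K`, `𝕄`; local `S`; coarse-local `M`; a bi-localised diagonal
generator family `g`; a `LocStencil₂` diagonal symbol family `h`; `N ≥ 1` ⇒ `(b, c) ↦ diagK (X₂⋆ b c)` is separation-localised, where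
`X₂⋆ b c p e := (Σ_κ Σ'_u colH K N b κ u · Σ_κ′ Σ'_u′ colH K N c κ′ u′ · h κ u κ′ u′ p e) + Σ_κ Σ'_u colH (K2OfK K N S M c + Ξ_c) N b κ u · g κ u p e`. -/
theorem sep_diagK_sharpSymbol [NeZero N] (hK : ∃ δ C : ℝ, 0 < δ ∧ 0 ≤ C ∧ Decays K C δ) (h𝕄 : ∃ δ C : ℝ, 0 < δ ∧ 0 ≤ C ∧ Decays 𝕄 C δ)
    {S : Fin (d + 1) → (Fin (d + 1) → ℤ) → MKer (d + 1) (Fib d)} (hS : ∃ Cs δs : ℝ, 0 < δs ∧ LocStencil S Cs δs)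
    {M : Fin (d + 1) → (Fin (d + 1) → ℤ) → MKer (d + 1) (Fib d)} (hM : ∃ CM δM : ℝ, 0 < δM ∧ VertexFamily M N CM δM)
    {g : Fin (d + 1) → (Fin (d + 1) → ℤ) → (Fin (d + 1) → ℤ) → Fib d → ℝ} (hgl : ∃ Cg δg : ℝ, 0 < δg ∧ LocStencil (fun κ u => diagK (g κ u)) Cg δg)
    {h : Fin (d + 1) → (Fin (d + 1) → ℤ) → Fin (d + 1) → (Fin (d + 1) → ℤ) → (Fin (d + 1) → ℤ) → Fib d → ℝ}
    (hhl : ∃ Ch δh : ℝ, 0 < δh ∧ LocStencil₂ (fun κ u κ' u' => diagK (h κ u κ' u')) Ch δh) :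
    ∃ C δ : ℝ, 0 < δ ∧ ∀ μ y ν y', BiLoc
      (diagK fun p c => (∑ κ, ∑' u, colH K N μ y κ u * ∑ κ', ∑' u', colH K N ν y' κ' u' * h κ u κ' u' p c) +
        ∑ κ, ∑' u, colH (K2OfK K N S M ν y' +
          -(comp (comp K (conjV 𝕄 (diagK fun p c => ∑ κ, ∑' u, colH K N ν y' κ u * g κ u p c))) K)) N μ y κ u * g κ u p c)
      ((N : ℤ) • y) ((N : ℤ) • y) (C * Real.exp (-δ * l1 ((N : ℤ) • y - (N : ℤ) • y'))) δ := by
  have e : (fun μ y ν y' => diagK fun p c => (∑ κ, ∑' u, colH K N μ y κ u * ∑ κ', ∑' u', colH K N ν y' κ' u' * h κ u κ' u' p c) +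
        ∑ κ, ∑' u, colH (K2OfK K N S M ν y' +
          -(comp (comp K (conjV 𝕄 (diagK fun p c => ∑ κ, ∑' u, colH K N ν y' κ u * g κ u p c))) K)) N μ y κ u * g κ u p c) =
      fun μ y ν y' => vertex2OfK K N (fun κ u κ' u' => diagK (h κ u κ' u')) μ y ν y' +
        vertexOfK (K2OfK K N S M ν y' +
          -(comp (comp K (conjV 𝕄 (diagK fun p c => ∑ κ, ∑' u, colH K N ν y' κ u * g κ u p c))) K)) N (fun κ u => diagK (g κ u)) μ y := by
    funext μ y ν y'
    rw [diagK_add', diagK_dressed₂_eq_vertex2OfK, diagK_dressed_eq_vertexOfK]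
  have h := sep_add (sep_vertex2OfK hK hhl)
    (sep_vertexOfK_diag_of_vertexFamily (A := fun ν y' => K2OfK K N S M ν y' +
        -(comp (comp K (conjV 𝕄 (diagK fun p c => ∑ κ, ∑' u, colH K N ν y' κ u * g κ u p c))) K))
      (vertexFamily_K2OfK_add_Xi hK h𝕄 hS hM hgl) hgl)
  obtain ⟨C, δ, hδ, h'⟩ := h
  refine ⟨C, δ, hδ, fun μ y ν y' => ?_⟩
  have e' := congrFun (congrFun (congrFun (congrFun e μ) y) ν) y'
  rw [e']
  exact h' μ y ν y'

end Sharp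


/-! ## §3 The explicit form of the OWNER's split defect at the (0.4) literal -/

section Literal

variable {Lc : ℕ} [NeZero Lc]

/-- [folklore] ONE COMMON RATE for the (0.4) letters at level `j`: the decay of `Gsym Lc j`, the locality of the pure recursive stencils, the
multiplier tables and the `γ_j`-scaled border-reading generator family. -/
theorem sym_letters_common (cΛ : ℝ) (γ : ℕ → ℝ) (j : ℕ) (α : Fin 4) :
    ∃ m C Cs CM Cg : ℝ, 0 < m ∧ 0 ≤ C ∧ Decays (Gsym (d := 3) Lc j) C m ∧
      LocStencil (SpureRecOf 3 Lc (symVhSAt (ctr 4 Lc) 3 Lc rfl) (symHessFFAt (ctr 4 Lc) Lc) (Gsym Lc) ((Lc : ℝ) ^ 4) (-((Lc : ℝ) ^ 8 / 2)) cΛ j) Cs m ∧ VertexFamily (M1Of 3 Lc (symHessFFAt (ctr 4 Lc) Lc) cΛ j) Lc CM m ∧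
      LocStencil (fun κ u => diagK fun p a => γ j * ctGenM 3 (bhK Lc + Dsh Lc) α Lc κ u p a) Cg m := by
  have hL1 : 1 ≤ Lc := one_le_of_neZero Lc
  obtain ⟨δK, C, hδK, hC, hKd⟩ := decays_Gsym (d := 3) Lc j
  obtain ⟨Cs, δs, hδs, hS⟩ := locStencil_SpureRecOf (d := 3) hL1 (symVhSAt_hV_ctr (d := 3) hL1) (symHessFFAt_hH_ctr (d := 3) hL1)
    (decays_Gsym Lc) ((Lc : ℝ) ^ 4) (-((Lc : ℝ) ^ 8 / 2)) cΛ j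
  obtain ⟨δB, CB, hδB, hCB, hBd⟩ := pkg_of_spr (spr_add (spr_bhK (d := 3) hL1) (spr_Dsh hL1))
  set m : ℝ := min (min δK δs) (δB / 2) with hm_def
  have hm : 0 < m := lt_min (lt_min hδK hδs) (half_pos hδB)
  have hmK : m ≤ δK := (min_le_left _ _).trans (min_le_left _ _)
  have hms : m ≤ δs := (min_le_left _ _).trans (min_le_right _ _)
  have hmB : m ≤ δB / 2 := min_le_right _ _
  obtain ⟨C1, hH1⟩ := symHessFFAt_hH_ctr (d := 3) hL1 m hm.le
  have hCs : 0 ≤ Cs := (hS 0 0).nonneg (Sum.inl 0)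
  exact ⟨m, C, Cs, _, _, hm, hC, decays_mono hKd hC le_rfl hmK, fun κ u => biLoc_mono (hS κ u) hCs hms, vertexFamily_M1Of hH1 cΛ j,
    fun κ u => biLoc_of_le (locStencil_diagK_mul_ctGenM hBd hδB.le (γ j) α Lc κ u) hmB⟩

/-- [folklore] **THE EXPLICIT FORM OF THE OWNER's SPLIT DEFECT** `SymSecondOrderRemainderAn1.symΔOfAt … j Rj α μ y ν y′` for ANY `LocStencil₂`
remainder family `Rj α`: the sharp second symbol's contact word MINUS the displayed `X2s`-contact word, PLUS the contact-kernel vertex `dM Ξ_c …`, PLUS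
the remainder bi-vertex and the two mixed-remainder vertices (leaf-10's `W2OfK_sharp_split_of_decay` at the (0.4) letters + an2's `W2OfK_add_slot₂`;
the comb twin is leaf-10's `SecondOrderSplitLiteral.W2OfK_sharp_split_literal₂`). -/
theorem symΔOfAt_eq_sharp (N : ℕ) (cΛ : ℝ) (γ : ℕ → ℝ)
    (X2s : ℕ → Fin 4 → Fin 4 → (Fin 4 → ℤ) → Fin 4 → (Fin 4 → ℤ) → (Fin 4 → ℤ) → Fib 3 → ℝ) (j : ℕ)
    {Rj : Fin 4 → Fin 4 → (Fin 4 → ℤ) → Fin 4 → (Fin 4 → ℤ) → MKer 4 (Fib 3)} (α : Fin 4)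
    (hR : ∃ C δ : ℝ, 0 < δ ∧ LocStencil₂ (Rj α) C δ) (μ : Fin 4) (y : Fin 4 → ℤ) (ν : Fin 4) (y' : Fin 4 → ℤ) :
    symΔOfAt Lc N cΛ γ X2s j Rj α μ y ν y' =
      conjW (bhKStepSh 3 Lc (Dsh Lc) j) (dM (Gsym Lc j) Lc (SpureRecOf 3 Lc (symVhSAt (ctr 4 Lc) 3 Lc rfl) (symHessFFAt (ctr 4 Lc) Lc) (Gsym Lc) ((Lc : ℝ) ^ 4) (-((Lc : ℝ) ^ 8 / 2)) cΛ j) (M1Of 3 Lc (symHessFFAt (ctr 4 Lc) Lc) cΛ j) μ y) (dM (Gsym Lc j) Lc (SpureRecOf 3 Lc (symVhSAt (ctr 4 Lc) 3 Lc rfl) (symHessFFAt (ctr 4 Lc) Lc) (Gsym Lc) ((Lc : ℝ) ^ 4) (-((Lc : ℝ) ^ 8 / 2)) cΛ j) (M1Of 3 Lc (symHessFFAt (ctr 4 Lc) Lc) cΛ j) ν y') (diagK fun p c => ∑ κ, ∑' u, colH (Gsym Lc j) Lc μ y κ u * (γ j * ctGenM 3 (bhK Lc + Dsh Lc) α Lc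 κ u p c))
          (diagK fun p c => ∑ κ', ∑' u', colH (Gsym Lc j) Lc ν y' κ' u' * (γ j * ctGenM 3 (bhK Lc + Dsh Lc) α Lc κ' u' p c)) (diagK fun p c => (∑ κ, ∑' u, colH (Gsym Lc j) Lc μ y κ u * ∑ κ', ∑' u', colH (Gsym Lc j) Lc ν y' κ' u' * ((γ j * ctGenM 3 (bhK Lc + Dsh Lc) α Lc κ u p c) * (γ j * ctGenM 3 (bhK Lc + Dsh Lc) α Lc κ' u' p c))) + ∑ κ, ∑' u, colH (K2OfK (Gsym Lc j) Lc (SpureRecOf 3 Lc (symVhSAt (ctr 4 Lc) 3 Lc rfl) (symHessFFAt (ctr 4 Lc) Lc) (Gsym Lc) ((Lc : ℝ) ^ 4) (-((Lc : ℝ) ^ 8 / 2)) cΛ j) (M1Of 3 Lc (symHessFFAt (ctr 4 Lc) Lc) cΛ j) ν y' + (-(comp (comp (Gsym Lc j) (conjV (bhKStepSh 3 Lc (Dsh Lc) j) (diagK fun p c => ∑ κ, ∑' u, colH (Gsym Lc j) Lc ν y' κ u * (γ j * ctGenM 3 (bhK Lc + Dsh Lc) α Lc κ u p c)))) (Gsym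 Lc j)))) Lc μ y κ u * (γ j * ctGenM 3 (bhK Lc + Dsh Lc) α Lc κ u p c)) +
        dM (-(comp (comp (Gsym Lc j) (conjV (bhKStepSh 3 Lc (Dsh Lc) j) (diagK fun p c => ∑ κ, ∑' u, colH (Gsym Lc j) Lc ν y' κ u * (γ j * ctGenM 3 (bhK Lc + Dsh Lc) α Lc κ u p c)))) (Gsym Lc j))) Lc (SpureRecOf 3 Lc (symVhSAt (ctr 4 Lc) 3 Lc rfl) (symHessFFAt (ctr 4 Lc) Lc) (Gsym Lc) ((Lc : ℝ) ^ 4) (-((Lc : ℝ) ^ 8 / 2)) cΛ j) (M1Of 3 Lc (symHessFFAt (ctr 4 Lc) Lc) cΛ j) μ y +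
        (vertex2OfK (Gsym Lc j) Lc (Rj α) μ y ν y' +
          (mixOfK (Gsym Lc j) Lc (symRMrAn1 Lc cΛ γ j α) μ y ν y' + mixOfK (Gsym Lc j) Lc (symRMrAn1 Lc cΛ γ j α) ν y' μ y)) -
        conjW (bhKStepSh 3 Lc (Dsh Lc) j) (dM (Gsym Lc j) Lc (SpureRecOf 3 Lc (symVhSAt (ctr 4 Lc) 3 Lc rfl) (symHessFFAt (ctr 4 Lc) Lc) (Gsym Lc) ((Lc : ℝ) ^ 4) (-((Lc : ℝ) ^ 8 / 2)) cΛ j) (M1Of 3 Lc (symHessFFAt (ctr 4 Lc) Lc) cΛ j) μ y) (dM (Gsym Lc j) Lc (SpureRecOf 3 Lc (symVhSAt (ctr 4 Lc) 3 Lc rfl) (symHessFFAt (ctr 4 Lc) Lc) (Gsym Lc) ((Lc : ℝ) ^ 4) (-((Lc : ℝ) ^ 8 / 2)) cΛ j) (M1Of 3 Lc (symHessFFAt (ctr 4 Lc) Lc) cΛ j) ν y') (diagK fun p c => ∑ κ, ∑' u, colH (Gsym Lc j) Lc μ y κ u * (γ j * ctGenM 3 (bhK Lc + Dsh Lc) α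 Lc κ u p c)) (diagK fun p c => ∑ κ, ∑' u, colH (Gsym Lc j) Lc ν y' κ u * (γ j * ctGenM 3 (bhK Lc + Dsh Lc) α Lc κ u p c)) (diagK (X2s j α μ y ν y')) := by
  have hL1 : 1 ≤ Lc := one_le_of_neZero Lc
  obtain ⟨m, C, Cs, CM, Cg, hm, hC, hG, hS, hM, hgl⟩ := sym_letters_common (Lc := Lc) cΛ γ j α
  have hK : ∃ δ C : ℝ, 0 < δ ∧ 0 ≤ C ∧ Decays (Gsym (d := 3) Lc j) C δ := ⟨m, C, hm, hC, hG⟩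
  obtain ⟨δB, CB, hδB, hCB, hBd⟩ := pkg_of_spr (spr_add (spr_bhK (d := 3) hL1) (spr_Dsh hL1))
  have hhb := abs_ctGenM_mul_ctGenM_le hBd hδB.le (γ j) (γ j) α Lc
  obtain ⟨B₂, δ₂, hδ₂, hT₂⟩ := locStencil₂_T2RecOf_symTablesAn1 (Lc := Lc) N cΛ j
  obtain ⟨CMx, δM, hδM, hMx⟩ := symMixFFAt_hmix_ctr (d := 3) hL1
  obtain ⟨C₂, δR, hδR, hR₂⟩ := hR
  obtain ⟨CR, δRM, hδRM, hRMl⟩ := locStencilFM_symRMrAn1 (Lc := Lc) cΛ γ j α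
  have hB₂ : ∀ κ u κ' u' x z a b, |(T2RecOf 3 Lc (Gsym Lc) (SpureRecOf 3 Lc (symVhSAt (ctr 4 Lc) 3 Lc rfl) (symHessFFAt (ctr 4 Lc) Lc) (Gsym Lc) ((Lc : ℝ) ^ 4) (-((Lc : ℝ) ^ 8 / 2)) cΛ) (M1Of 3 Lc (symHessFFAt (ctr 4 Lc) Lc) cΛ) ((Lc : ℝ) ^ 8) (-((Lc : ℝ) ^ 12 / 4)) ((8 * (N : ℝ) ^ 2)⁻¹ • wsym22 N) (symVh₂SAn1 3 Lc) (symMixFFAt (ctr 4 Lc) Lc) j) κ u κ' u' x z a b| ≤ B₂ := fun κ u κ' u' x z a b => abs_le_of_locStencil₂ hT₂ hδ₂.le κ u κ' u' x z a b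
  have hR₂b : ∀ κ u κ' u' x z a b, |Rj α κ u κ' u' x z a b| ≤ C₂ := fun κ u κ' u' x z a b => abs_le_of_locStencil₂ hR₂ hδR.le κ u κ' u' x z a b
  have hBM : ∀ κ u ρ w x z a b, |(M2Of 3 Lc (symMixFFAt (ctr 4 Lc) Lc) j) κ u ρ w x z a b| ≤ |BalabanStepW2.wM2 3 Lc j| * CMx :=
    fun κ u ρ w x z a b => abs_le_of_locStencilFM (locStencilFM_M2Of hMx j) hδM.le κ u ρ w x z a b
  have hRMb : ∀ κ u ρ w x z a b, |symRMrAn1 Lc cΛ γ j α κ u ρ w x z a b| ≤ CR :=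
    fun κ u ρ w x z a b => abs_le_of_locStencilFM hRMl hδRM.le κ u ρ w x z a b
  have hB₂' : ∀ κ u κ' u' x z a b, |((T2RecOf 3 Lc (Gsym Lc) (SpureRecOf 3 Lc (symVhSAt (ctr 4 Lc) 3 Lc rfl) (symHessFFAt (ctr 4 Lc) Lc) (Gsym Lc) ((Lc : ℝ) ^ 4) (-((Lc : ℝ) ^ 8 / 2)) cΛ) (M1Of 3 Lc (symHessFFAt (ctr 4 Lc) Lc) cΛ) ((Lc : ℝ) ^ 8) (-((Lc : ℝ) ^ 12 / 4)) ((8 * (N : ℝ) ^ 2)⁻¹ • wsym22 N) (symVh₂SAn1 3 Lc) (symMixFFAt (ctr 4 Lc) Lc) j) κ u κ' u' + Rj α κ u κ' u') x z a b| ≤ B₂ + C₂ := fun κ u κ' u' x z a b => by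
    rw [Pi.add_apply, Pi.add_apply, Pi.add_apply, Pi.add_apply]
    exact (abs_add_le _ _).trans (add_le_add (hB₂ κ u κ' u' x z a b) (hR₂b κ u κ' u' x z a b))
  have hBM' : ∀ κ u ρ w x z a b, |((M2Of 3 Lc (symMixFFAt (ctr 4 Lc) Lc) j) κ u ρ w + symRMrAn1 Lc cΛ γ j α κ u ρ w) x z a b| ≤ |BalabanStepW2.wM2 3 Lc j| * CMx + CR :=
    fun κ u ρ w x z a b => by
      rw [Pi.add_apply, Pi.add_apply, Pi.add_apply, Pi.add_apply]
      exact (abs_add_le _ _).trans (add_le_add (hBM κ u ρ w x z a b) (hRMb κ u ρ w x z a b))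
  unfold SymSecondOrderRemainderAn1.symΔOfAt
  -- regroup both remainders next to the plain tables
  rw [show (fun κ u κ' u' => (T2RecOf 3 Lc (Gsym Lc) (SpureRecOf 3 Lc (symVhSAt (ctr 4 Lc) 3 Lc rfl) (symHessFFAt (ctr 4 Lc) Lc) (Gsym Lc) ((Lc : ℝ) ^ 4) (-((Lc : ℝ) ^ 8 / 2)) cΛ) (M1Of 3 Lc (symHessFFAt (ctr 4 Lc) Lc) cΛ) ((Lc : ℝ) ^ 8) (-((Lc : ℝ) ^ 12 / 4)) ((8 * (N : ℝ) ^ 2)⁻¹ • wsym22 N) (symVh₂SAn1 3 Lc) (symMixFFAt (ctr 4 Lc) Lc) j) κ u κ' u' +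
          conjW (bhKStepSh 3 Lc (Dsh Lc) j) ((SpureRecOf 3 Lc (symVhSAt (ctr 4 Lc) 3 Lc rfl) (symHessFFAt (ctr 4 Lc) Lc) (Gsym Lc) ((Lc : ℝ) ^ 4) (-((Lc : ℝ) ^ 8 / 2)) cΛ j) κ u) ((SpureRecOf 3 Lc (symVhSAt (ctr 4 Lc) 3 Lc rfl) (symHessFFAt (ctr 4 Lc) Lc) (Gsym Lc) ((Lc : ℝ) ^ 4) (-((Lc : ℝ) ^ 8 / 2)) cΛ j) κ' u')
            (diagK fun p c => γ j * ctGenM 3 (bhK Lc + Dsh Lc) α Lc κ u p c) (diagK fun p c => γ j * ctGenM 3 (bhK Lc + Dsh Lc) α Lc κ' u' p c) (diagK fun p c => (γ j * ctGenM 3 (bhK Lc + Dsh Lc) α Lc κ u p c) * (γ j * ctGenM 3 (bhK Lc + Dsh Lc) α Lc κ' u' p c)) +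
          Rj α κ u κ' u') =
        (fun κ u κ' u' => ((T2RecOf 3 Lc (Gsym Lc) (SpureRecOf 3 Lc (symVhSAt (ctr 4 Lc) 3 Lc rfl) (symHessFFAt (ctr 4 Lc) Lc) (Gsym Lc) ((Lc : ℝ) ^ 4) (-((Lc : ℝ) ^ 8 / 2)) cΛ) (M1Of 3 Lc (symHessFFAt (ctr 4 Lc) Lc) cΛ) ((Lc : ℝ) ^ 8) (-((Lc : ℝ) ^ 12 / 4)) ((8 * (N : ℝ) ^ 2)⁻¹ • wsym22 N) (symVh₂SAn1 3 Lc) (symMixFFAt (ctr 4 Lc) Lc) j) κ u κ' u' + Rj α κ u κ' u') +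
          conjW (bhKStepSh 3 Lc (Dsh Lc) j) ((SpureRecOf 3 Lc (symVhSAt (ctr 4 Lc) 3 Lc rfl) (symHessFFAt (ctr 4 Lc) Lc) (Gsym Lc) ((Lc : ℝ) ^ 4) (-((Lc : ℝ) ^ 8 / 2)) cΛ j) κ u) ((SpureRecOf 3 Lc (symVhSAt (ctr 4 Lc) 3 Lc rfl) (symHessFFAt (ctr 4 Lc) Lc) (Gsym Lc) ((Lc : ℝ) ^ 4) (-((Lc : ℝ) ^ 8 / 2)) cΛ j) κ' u')
            (diagK fun p c => γ j * ctGenM 3 (bhK Lc + Dsh Lc) α Lc κ u p c) (diagK fun p c => γ j * ctGenM 3 (bhK Lc + Dsh Lc) α Lc κ' u' p c) (diagK fun p c => (γ j * ctGenM 3 (bhK Lc + Dsh Lc) α Lc κ u p c) * (γ j * ctGenM 3 (bhK Lc + Dsh Lc) α Lc κ' u' p c)))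
      from funext fun κ => funext fun u => funext fun κ' => funext fun u' => add_right_comm _ _ _,
    show (fun κ u ρ w => (M2Of 3 Lc (symMixFFAt (ctr 4 Lc) Lc) j) κ u ρ w + conjV ((M1Of 3 Lc (symHessFFAt (ctr 4 Lc) Lc) cΛ j) ρ w) (diagK fun p c => γ j * ctGenM 3 (bhK Lc + Dsh Lc) α Lc κ u p c) +
          symRMrAn1 Lc cΛ γ j α κ u ρ w) =
        (fun κ u ρ w => ((M2Of 3 Lc (symMixFFAt (ctr 4 Lc) Lc) j) κ u ρ w + symRMrAn1 Lc cΛ γ j α κ u ρ w) +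
          conjV ((M1Of 3 Lc (symHessFFAt (ctr 4 Lc) Lc) cΛ j) ρ w) (diagK fun p c => γ j * ctGenM 3 (bhK Lc + Dsh Lc) α Lc κ u p c))
      from funext fun κ => funext fun u => funext fun ρ => funext fun w => add_right_comm _ _ _]
  rw [W2OfK_sharp_split_of_decay (N := Lc) hG hC hm (spr_bhKStepSh (spr_Dsh hL1) j) hS hM
      (S₂ := fun κ u κ' u' => (T2RecOf 3 Lc (Gsym Lc) (SpureRecOf 3 Lc (symVhSAt (ctr 4 Lc) 3 Lc rfl) (symHessFFAt (ctr 4 Lc) Lc) (Gsym Lc) ((Lc : ℝ) ^ 4) (-((Lc : ℝ) ^ 8 / 2)) cΛ) (M1Of 3 Lc (symHessFFAt (ctr 4 Lc) Lc) cΛ) ((Lc : ℝ) ^ 8) (-((Lc : ℝ) ^ 12 / 4)) ((8 * (N : ℝ) ^ 2)⁻¹ • wsym22 N) (symVh₂SAn1 3 Lc) (symMixFFAt (ctr 4 Lc) Lc) j) κ u κ' u' + Rj α κ u κ' u')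
      (M₂ := fun κ u ρ w => (M2Of 3 Lc (symMixFFAt (ctr 4 Lc) Lc) j) κ u ρ w + symRMrAn1 Lc cΛ γ j α κ u ρ w) hB₂' hBM' hgl hhb μ y ν y',
    W2OfK_add_slot₂ hK _ _ hB₂ hR₂b hBM hRMb μ y ν y']
  abel

/-! ## §4 THE Δ-HALF OF THE CLASS STEP: the OWNER's signature -/

/-- [folklore] **`symΔAn1 … j α` IS SEPARATION-LOCALISED FROM THE CLASSES OF `X2s j α` AND `symR2An1 … j α`** — the row-D1 OWNER's requested
signature (R-D1-g33-0): `hX` in the currency of `SymSecondOrderClassStep.locStencil₂_symR2An1_succ` and the conclusion = its `hΔ`.  By §3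
(with `Rj := symR2An1 … j`), §1 twice (the two contact words: sharp symbol by §2, displayed symbol by `hX`), leaf-05's `sep_dM_of_vertexFamily`
(over `vertexFamily_Xi`), `sep_vertex2OfK` (`hR2`), `sep_mixOfK ∕ _swap` (`SymMixedRemainderClass.locStencilFM_symRMrAn1`). -/
theorem sep_symΔAn1_of_classes (N : ℕ) (cΛ : ℝ) (γ : ℕ → ℝ)
    (X2s : ℕ → Fin 4 → Fin 4 → (Fin 4 → ℤ) → Fin 4 → (Fin 4 → ℤ) → (Fin 4 → ℤ) → Fib 3 → ℝ) (j : ℕ) (α : Fin 4)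
    (hX : ∃ C δ : ℝ, 0 < δ ∧ ∀ μ y ν y', BiLoc (diagK (X2s j α μ y ν y')) ((Lc : ℤ) • y) ((Lc : ℤ) • y)
      (C * Real.exp (-δ * l1 ((Lc : ℤ) • y - (Lc : ℤ) • y'))) δ)
    (hR2 : ∃ C δ : ℝ, 0 < δ ∧ LocStencil₂ (symR2An1 Lc N cΛ γ X2s j α) C δ) :
    ∃ C δ : ℝ, 0 < δ ∧ ∀ μ y ν y', BiLoc (symΔAn1 Lc N cΛ γ X2s j α μ y ν y') ((Lc : ℤ) • y) ((Lc : ℤ) • y)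
      (C * Real.exp (-δ * l1 ((Lc : ℤ) • y - (Lc : ℤ) • y'))) δ := by
  have hL1 : 1 ≤ Lc := one_le_of_neZero Lc
  obtain ⟨m, C, Cs, CM, Cg, hm, hC, hG, hS, hM, hgl⟩ := sym_letters_common (Lc := Lc) cΛ γ j α
  have hK : ∃ δ C : ℝ, 0 < δ ∧ 0 ≤ C ∧ Decays (Gsym (d := 3) Lc j) C δ := ⟨m, C, hm, hC, hG⟩
  have h𝕄 : ∃ δ C : ℝ, 0 < δ ∧ 0 ≤ C ∧ Decays (bhKStepSh 3 Lc (Dsh Lc) j) C δ := pkg_of_spr (spr_bhKStepSh (spr_Dsh hL1) j)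
  have hS' : ∃ Cs δs : ℝ, 0 < δs ∧ LocStencil (SpureRecOf 3 Lc (symVhSAt (ctr 4 Lc) 3 Lc rfl) (symHessFFAt (ctr 4 Lc) Lc) (Gsym Lc) ((Lc : ℝ) ^ 4) (-((Lc : ℝ) ^ 8 / 2)) cΛ j) Cs δs := ⟨Cs, m, hm, hS⟩
  have hM' : ∃ CM δM : ℝ, 0 < δM ∧ VertexFamily (M1Of 3 Lc (symHessFFAt (ctr 4 Lc) Lc) cΛ j) Lc CM δM := ⟨CM, m, hm, hM⟩
  have hgl' : ∃ Cg δg : ℝ, 0 < δg ∧ LocStencil (fun κ u => diagK fun p a => γ j * ctGenM 3 (bhK Lc + Dsh Lc) α Lc κ u p a) Cg δg := ⟨Cg, m, hm, hgl⟩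
  obtain ⟨δB, CB, hδB, hCB, hBd⟩ := pkg_of_spr (spr_add (spr_bhK (d := 3) hL1) (spr_Dsh hL1))
  have hhl : ∃ Ch δh : ℝ, 0 < δh ∧ LocStencil₂ (fun κ u κ' u' => diagK fun p a =>
      (γ j * ctGenM 3 (bhK Lc + Dsh Lc) α Lc κ u p a) * (γ j * ctGenM 3 (bhK Lc + Dsh Lc) α Lc κ' u' p a)) Ch δh :=
    ⟨_, δB / 3, by positivity, locStencil₂_diagK_ctGenM_mul_ctGenM hBd hδB.le (γ j) (γ j) α Lc⟩
  -- the vertex families entering the two contact words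
  have hA := vertexFamily_dM' (N := Lc) hK hS' hM'
  have hD := vertexFamily_dressedGen (N := Lc) hK hgl'
  -- the pieces
  have wS := sep_conjW_word (N := Lc) h𝕄 hA hD (sep_diagK_sharpSymbol (N := Lc) hK h𝕄 hS' hM' hgl' hhl)
  have w₀ := sep_conjW_word (N := Lc) h𝕄 hA hD hX
  have wΞ := sep_dM_of_vertexFamily (N := Lc) (vertexFamily_Xi (N := Lc) hK h𝕄 hgl') hS' hM'
  have wR := sep_vertex2OfK (N := Lc) hK hR2
  have wM := sep_mixOfK (N := Lc) hK (locStencilFM_symRMrAn1 (Lc := Lc) cΛ γ j α)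
  have wM' := sep_mixOfK_swap (N := Lc) hK (locStencilFM_symRMrAn1 (Lc := Lc) cΛ γ j α)
  have h := sep_sub (sep_add (sep_add wS wΞ) (sep_add wR (sep_add wM wM'))) w₀
  obtain ⟨C', δ', hδ', h'⟩ := h
  refine ⟨C', δ', hδ', fun μ y ν y' => ?_⟩
  have e : symΔAn1 Lc N cΛ γ X2s j α μ y ν y' = symΔOfAt Lc N cΛ γ X2s j (symR2An1 Lc N cΛ γ X2s j) α μ y ν y' := rfl
  rw [e, symΔOfAt_eq_sharp (Lc := Lc) N cΛ γ X2s j (Rj := symR2An1 Lc N cΛ γ X2s j) α hR2 μ y ν y']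
  exact h' μ y ν y'

/-! ## §5 THE CLASS INDUCTION and ROOT L∕M's `hΔL` -/

/-- [folklore] **THE TWO-CLASS INDUCTION**: if the free table `X2s · α` is separation-localised at every level, then at every level `j` the OWNER's
recursive remainder `symR2An1 … j α` is `LocStencil₂` AND the split defect `symΔAn1 … j α` is separation-localised (base
`SymSecondOrderClassBase.locStencil₂_symR2An1_zero`; step `SymSecondOrderClassStep.locStencil₂_symR2An1_succ` + §4). -/
theorem classes_symR2An1_symΔAn1 (N : ℕ) (cΛ : ℝ) (γ : ℕ → ℝ)
    (X2s : ℕ → Fin 4 → Fin 4 → (Fin 4 → ℤ) → Fin 4 → (Fin 4 → ℤ) → (Fin 4 → ℤ) → Fib 3 → ℝ) (α : Fin 4)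
    (hX : ∀ j : ℕ, ∃ C δ : ℝ, 0 < δ ∧ ∀ μ y ν y', BiLoc (diagK (X2s j α μ y ν y')) ((Lc : ℤ) • y) ((Lc : ℤ) • y)
      (C * Real.exp (-δ * l1 ((Lc : ℤ) • y - (Lc : ℤ) • y'))) δ) :
    ∀ j : ℕ, (∃ C δ : ℝ, 0 < δ ∧ LocStencil₂ (symR2An1 Lc N cΛ γ X2s j α) C δ) ∧
      (∃ C δ : ℝ, 0 < δ ∧ ∀ μ y ν y', BiLoc (symΔAn1 Lc N cΛ γ X2s j α μ y ν y') ((Lc : ℤ) • y) ((Lc : ℤ) • y)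
        (C * Real.exp (-δ * l1 ((Lc : ℤ) • y - (Lc : ℤ) • y'))) δ)
  | 0 => by
    have h0 := locStencil₂_symR2An1_zero (Lc := Lc) N cΛ γ X2s α
    exact ⟨h0, sep_symΔAn1_of_classes N cΛ γ X2s 0 α (hX 0) h0⟩
  | j + 1 => by
    obtain ⟨hRj, hΔj⟩ := classes_symR2An1_symΔAn1 N cΛ γ X2s α hX j
    have hR := locStencil₂_symR2An1_succ (Lc := Lc) N cΛ γ X2s j α (hX j) hΔj
    exact ⟨hR, sep_symΔAn1_of_classes N cΛ γ X2s (j + 1) α (hX (j + 1)) hR⟩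

/-- [folklore] Corollary: every `symR2An1 … j α` is a `LocStencil₂` family. -/
theorem locStencil₂_symR2An1 (N : ℕ) (cΛ : ℝ) (γ : ℕ → ℝ)
    (X2s : ℕ → Fin 4 → Fin 4 → (Fin 4 → ℤ) → Fin 4 → (Fin 4 → ℤ) → (Fin 4 → ℤ) → Fib 3 → ℝ) (α : Fin 4)
    (hX : ∀ j : ℕ, ∃ C δ : ℝ, 0 < δ ∧ ∀ μ y ν y', BiLoc (diagK (X2s j α μ y ν y')) ((Lc : ℤ) • y) ((Lc : ℤ) • y)
      (C * Real.exp (-δ * l1 ((Lc : ℤ) • y - (Lc : ℤ) • y'))) δ) (j : ℕ) :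
    ∃ C δ : ℝ, 0 < δ ∧ LocStencil₂ (symR2An1 Lc N cΛ γ X2s j α) C δ :=
  (classes_symR2An1_symΔAn1 N cΛ γ X2s α hX j).1

/-- [folklore] Corollary: every `symΔAn1 … j α` is separation-localised. -/
theorem sep_symΔAn1 (N : ℕ) (cΛ : ℝ) (γ : ℕ → ℝ)
    (X2s : ℕ → Fin 4 → Fin 4 → (Fin 4 → ℤ) → Fin 4 → (Fin 4 → ℤ) → (Fin 4 → ℤ) → Fib 3 → ℝ) (α : Fin 4)
    (hX : ∀ j : ℕ, ∃ C δ : ℝ, 0 < δ ∧ ∀ μ y ν y', BiLoc (diagK (X2s j α μ y ν y')) ((Lc : ℤ) • y) ((Lc : ℤ) • y)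
      (C * Real.exp (-δ * l1 ((Lc : ℤ) • y - (Lc : ℤ) • y'))) δ) (j : ℕ) :
    ∃ C δ : ℝ, 0 < δ ∧ ∀ μ y ν y', BiLoc (symΔAn1 Lc N cΛ γ X2s j α μ y ν y') ((Lc : ℤ) • y) ((Lc : ℤ) • y)
      (C * Real.exp (-δ * l1 ((Lc : ℤ) • y - (Lc : ℤ) • y'))) δ :=
  (classes_symR2An1_symΔAn1 N cΛ γ X2s α hX j).2

/-- [folklore] **ROOT L's BINDER `hΔL` UNDER THE `X2s` CLASS** (pointwise localisation of the defined split defect): if `X2s j α` is separation-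
localised for all `j`, `α`, then `Loc (symΔAn1 … j α μ y ν y′)` for all `j α μ y ν y′`. -/
theorem loc_symΔAn1 (N : ℕ) (cΛ : ℝ) (γ : ℕ → ℝ)
    (X2s : ℕ → Fin 4 → Fin 4 → (Fin 4 → ℤ) → Fin 4 → (Fin 4 → ℤ) → (Fin 4 → ℤ) → Fib 3 → ℝ)
    (hX : ∀ (j : ℕ) (α : Fin 4), ∃ C δ : ℝ, 0 < δ ∧ ∀ μ y ν y', BiLoc (diagK (X2s j α μ y ν y')) ((Lc : ℤ) • y) ((Lc : ℤ) • y)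
      (C * Real.exp (-δ * l1 ((Lc : ℤ) • y - (Lc : ℤ) • y'))) δ) :
    ∀ (j : ℕ) (α μ : Fin 4) (y : Fin 4 → ℤ) (ν : Fin 4) (y' : Fin 4 → ℤ), Loc (symΔAn1 Lc N cΛ γ X2s j α μ y ν y') := by
  intro j α μ y ν y'
  obtain ⟨C, δ, hδ, h⟩ := sep_symΔAn1 (Lc := Lc) N cΛ γ X2s α (fun j => hX j α) j
  exact ⟨_, _, _, δ, hδ, h μ y ν y'⟩

omit [NeZero Lc] in
/-- [folklore] The zero table is separation-localised (trivially). -/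
theorem sep_zeroTable :
    ∀ (j : ℕ) (α : Fin 4), ∃ C δ : ℝ, 0 < δ ∧ ∀ (μ : Fin 4) (y : Fin 4 → ℤ) (ν : Fin 4) (y' : Fin 4 → ℤ),
      BiLoc (diagK ((0 : ℕ → Fin 4 → Fin 4 → (Fin 4 → ℤ) → Fin 4 → (Fin 4 → ℤ) → (Fin 4 → ℤ) → Fib 3 → ℝ) j α μ y ν y'))
        ((Lc : ℤ) • y) ((Lc : ℤ) • y) (C * Real.exp (-δ * l1 ((Lc : ℤ) • y - (Lc : ℤ) • y'))) δ := by
  classical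
  intro j α
  refine ⟨0, 1, one_pos, fun μ y ν y' x z a b => ?_⟩
  simp [BorderedHessian.diagK_apply]

/-- [folklore] **ROOT M's BINDER `hΔL` — UNCONDITIONALLY**: at the pin `X2s := 0` the `X2s` class is trivial, so for EVERY `N`, `cΛ`, `γ` and all
`j α μ y ν y′`, `Loc (symΔAn1 Lc N cΛ γ 0 j α μ y ν y′)` (in particular at ROOT M's displayed `γ`). -/
theorem hΔL_pinned (N : ℕ) (cΛ : ℝ) (γ : ℕ → ℝ) :
    ∀ (j : ℕ) (α μ : Fin 4) (y : Fin 4 → ℤ) (ν : Fin 4) (y' : Fin 4 → ℤ),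
      Loc (symΔAn1 Lc N cΛ γ (0 : ℕ → Fin 4 → Fin 4 → (Fin 4 → ℤ) → Fin 4 → (Fin 4 → ℤ) → (Fin 4 → ℤ) → Fib 3 → ℝ) j α μ y ν y') :=
  loc_symΔAn1 (Lc := Lc) N cΛ γ 0 (sep_zeroTable (Lc := Lc))

end Literal

end Summit.QuantumFields.BalabanUV.Beta.SymSecondOrderDeltaSep

end
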